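import Mathlib
import Summits.Ventures.HodgeRepro2.T6N2ToyIso

/-!
# T6N2ToyIsoS — the explicit-isometry N2 datum with its ADMISSIBLE SETS AS PARAMETERS (owner t6-p5;
for the joint toy over the lead's re-cut carrier, t6-lead STATUS l. 11255 (3)(b), t6-p1 l. 11204)

T6N2ToyIso's `toyIso` / `toyIsoF` fix the admissible Schwartz sets to `Set.univ` — closed under
ℂ-scaling, which is NOT what the host's admissible data are: by TIER4 B7(b)–(c) / Lemma A7.3(b) the
admissible choices are the ℚ-RATIONAL homomorphisms `φ_i ∈ Hom_E(A_K, A_{μ_i})_ℚ` (and the coordinate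
projections), a ℚ-vector space whose image under Liu Thm. 4.18(1) is a ℚ-form of the `K`-fixed
Schwartz data (closed under ℚ-scaling, ℂ-spanning — t6-p3's `AdmGenerating` — but NOT closed under
ℂ-scaling), and the period is ℚ-multilinear in them, so its values over admissible choices lie in a
countable set — exactly the set t6-p1's obstruction (l. 11204 (2)) requires. A joint toy that carries
N1's displays must therefore take ℚ-rational admissible sets. Nothing in N2's conclusion depends on
the admissible sets (`Adm` = μ-admissibility ∧ the isometry ∧ (H_χ) is about `τ`, `e₁₁₁`, `e₁₀₀`,
`u`, the characters): this file is `toyIso` with the four sets as PARAMETERS — `toyIsoS F P 𝒟 hfr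
admA admB admC admD` with `toyIsoS_adm` (no hypothesis), `toyIsoSF` on any face setting, and the
M2-carrier corollary `ofNAut_toyIsoSF_admDatum`; `toyIsoS … univ univ univ univ = toyIso …` by
`rfl`. `AdmSpanning` / `AdmGenerating` for a choice of sets is the consumer's (t6-p3's lemmas:
`admSpanning_of_univ` for `univ`; for a ℚ-form, the ℂ-span statement).

README §8(d): uses an L-value-free non-vanishing device: NO (TIER5 §N2, a pre-02:16Z line of
record — N2 asserts no non-vanishing — continued).
-/

namespace Summit.Ventures.HodgeRepro2.T6.N2ToyIsoS

open Summit.Ventures.HodgeRepro2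
open Summit.Ventures.HodgeRepro2.T5CubeTypes
open Summit.Ventures.HodgeRepro2.T6.N2ToyIso

variable {K : Type*} [Field K] [NumberField K] [NumberField.IsCMField K]

/-- THE TOY DATUM WITH AN EXPLICIT ISOMETRY AND PRESCRIBED ADMISSIBLE SETS: `e₁₁₁ := e111Of`,
`u := uOf`, `e₁₀₀ := u (1 − u) e₁₁₁`, `Char := Unit`, the admissible sets as given. -/
noncomputable def toyIsoS (F : FaceSetting K) (P : NDatum F) (𝒟 : N3Datum)
    {τ : Fin 3 → (K →+* ℂ)} (hfr : IsCMFrame τ)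
    (admA : Set 𝒟.A.Sa) (admB : Set 𝒟.A.Sb) (admC : Set 𝒟.B.Sa) (admD : Set 𝒟.B.Sb) :
    N2Datum F P 𝒟 :=
  N2Datum.mk τ (e111Of hfr) (uOf hfr * (1 - uOf hfr) * e111Of hfr) (uOf hfr) Unit () ()
    admA admB admC admD

/-- At `Set.univ` this is `toyIso`. -/
theorem toyIsoS_univ (F : FaceSetting K) (P : NDatum F) (𝒟 : N3Datum)
    {τ : Fin 3 → (K →+* ℂ)} (hfr : IsCMFrame τ) :
    toyIsoS F P 𝒟 hfr Set.univ Set.univ Set.univ Set.univ = toyIso F P 𝒟 hfr := rfl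

/-- `Adm` with NO hypothesis, for every choice of admissible sets (N2's conclusion does not see
them). -/
theorem toyIsoS_adm (F : FaceSetting K) (P : NDatum F) (𝒟 : N3Datum)
    {τ : Fin 3 → (K →+* ℂ)} (hfr : IsCMFrame τ)
    (admA : Set 𝒟.A.Sa) (admB : Set 𝒟.A.Sb) (admC : Set 𝒟.B.Sa) (admD : Set 𝒟.B.Sb) :
    (toyIsoS F P 𝒟 hfr admA admB admC admD).Adm :=
  adm_of_explicit _ hfr (isLiuSignElement_e111Of hfr) (magSpec_uOf hfr) rfl

/-- The admissible sets of `toyIsoS` are the given ones (`rfl`), so `AdmData` is membership. -/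
theorem toyIsoS_admData_iff (F : FaceSetting K) (P : NDatum F) (𝒟 : N3Datum)
    {τ : Fin 3 → (K →+* ℂ)} (hfr : IsCMFrame τ)
    (admA : Set 𝒟.A.Sa) (admB : Set 𝒟.A.Sb) (admC : Set 𝒟.B.Sa) (admD : Set 𝒟.B.Sb)
    (φ : 𝒟.A.Sa × 𝒟.A.Sb × 𝒟.B.Sa × 𝒟.B.Sb) :
    (toyIsoS F P 𝒟 hfr admA admB admC admD).AdmData φ ↔
      φ.1 ∈ admA ∧ φ.2.1 ∈ admB ∧ φ.2.2.1 ∈ admC ∧ φ.2.2.2 ∈ admD :=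
  Iff.rfl

/-- On any face setting: the face setting's `deg6` supplies the frame. -/
noncomputable def toyIsoSF (F : FaceSetting K) (P : NDatum F) (𝒟 : N3Datum)
    (admA : Set 𝒟.A.Sa) (admB : Set 𝒟.A.Sb) (admC : Set 𝒟.B.Sa) (admD : Set 𝒟.B.Sb) :
    N2Datum F P 𝒟 :=
  toyIsoS F P 𝒟 (isCMFrame_frameOf F.deg6) admA admB admC admD

/-- `Adm` on the face setting's datum with prescribed admissible sets, no binder. -/
theorem toyIsoSF_adm (F : FaceSetting K) (P : NDatum F) (𝒟 : N3Datum)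
    (admA : Set 𝒟.A.Sa) (admB : Set 𝒟.A.Sb) (admC : Set 𝒟.B.Sa) (admD : Set 𝒟.B.Sb) :
    (toyIsoSF F P 𝒟 admA admB admC admD).Adm :=
  toyIsoS_adm F P 𝒟 _ admA admB admC admD

/-- THE N2 BLOCK ON ANY v1 CARRIER WITH PRESCRIBED ADMISSIBLE SETS: `NAut2.ofNAut M₁ (toyIsoSF …)`
has `AdmDatum` with no hypothesis, whatever the sets (so a joint toy may take ℚ-rational ones). -/
theorem ofNAut_toyIsoSF_admDatum {F : FaceSetting K} {P : NDatum F} (M₁ : NAut F P)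
    (admA : Set M₁.d3.A.Sa) (admB : Set M₁.d3.A.Sb) (admC : Set M₁.d3.B.Sa)
    (admD : Set M₁.d3.B.Sb) :
    (NAut2.ofNAut M₁ (toyIsoSF F P M₁.d3 admA admB admC admD)).AdmDatum :=
  toyIsoSF_adm F P M₁.d3 admA admB admC admD

/-- `N2_main_explicit`'s four binders hold on `toyIsoSF` for every choice of sets (the datum's
explicit shape does not see them): the display-free M2 consumption on any v2 carrier whose `d2` is
`toyIsoSF …` — stated as the conjunction the lead's `periodInputN_of_published₅₋₆` binder block
takes. -/
theorem toyIsoSF_explicitShape (F : FaceSetting K) (P : NDatum F) (𝒟 : N3Datum)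
    (admA : Set 𝒟.A.Sa) (admB : Set 𝒟.A.Sb) (admC : Set 𝒟.B.Sa) (admD : Set 𝒟.B.Sb) :
    IsCMFrame (toyIsoSF F P 𝒟 admA admB admC admD).τ ∧
      IsLiuSignElement K ((toyIsoSF F P 𝒟 admA admB admC admD).type T5DatumSimilitude.t111)
        (toyIsoSF F P 𝒟 admA admB admC admD).e₁₁₁ ∧
      MagSpec (toyIsoSF F P 𝒟 admA admB admC admD).τ (toyIsoSF F P 𝒟 admA admB admC admD).u ∧
      (toyIsoSF F P 𝒟 admA admB admC admD).e₁₀₀ =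
        (toyIsoSF F P 𝒟 admA admB admC admD).u * (1 - (toyIsoSF F P 𝒟 admA admB admC admD).u) *
          (toyIsoSF F P 𝒟 admA admB admC admD).e₁₁₁ :=
  ⟨isCMFrame_frameOf F.deg6, isLiuSignElement_e111Of (isCMFrame_frameOf F.deg6),
    magSpec_uOf (isCMFrame_frameOf F.deg6), rfl⟩

end Summit.Ventures.HodgeRepro2.T6.N2ToyIsoS
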